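import Mathlib
import HarnessLib
import Summits.Ventures.LatticeQCDFlow.Exactness.CabibboMarinariKicks

/-!
# Frames and their pairs; the lexicographic word of pair laws and its reverse dominate Haar on `SU(N)`

HONEST FRAMING: exact (Metropolis-corrected) sampling algorithms for lattice gauge theory;
figures of merit are autocorrelation/cost numbers at stated couplings and volumes; no
continuum-physics claim.

Venture `LatticeQCDFlow` (cell pub-lqcd), topic `Exactness`, FANOUT row 9 (eng-latcore, the
engine `latflow.core`; `update_link` in `csrc/latcore_template.c` runs one Cabibbo–Marinari
heat-bath hit per coordinate pair `(i, j)`, `i < j`, lexicographically).  NEW WORK of the cell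
over Mathlib and row 9's earlier files; nothing is cited as a fact.  Printed counterparts, NAMED
ONLY: Diaconis–Shahshahani 1987 (subgroup algorithm); Meyn–Tweedie 1993 Thm 16.0.2 (Doeblin ⇒
uniform ergodicity); Cabibbo–Marinari 1982 (the update).  Part of the proof that the SU(N ≥ 3)
Cabibbo–Marinari heat bath is uniformly ergodic.

## What is proved (`n` a finite nonempty index type; `SU(N) = Matrix.specialUnitaryGroup n ℂ`)

* `pairOf e`, `pairOf_ne`; **`blockEmb_apply_eq`** / **`blockEmbSU_eq_pairHom`** — the block
  embedding of a frame depends only on its ordered pair (so the engine's subgroup `(i, j)` is modelled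
  by ANY frame with that pair); `map_blockEmbSU_eq_pairLaw'`.
* `lexPairs L` and `lexLaw_eq_listConv`; `map_inv_mconv`, `map_inv_listConv`, `pairLaw'_map_inv`
  (inversion reverses words, pair laws are inversion invariant);
  **`smul_haar_le_listConv_pairs`** — `c • Haar_{SU(N)} ≤` the list convolution of the pair laws over
  the lexicographic word, and over its REVERSE (the engine's forward scan).

NOT CLAIMED: other words in the pairs.
-/

namespace Summit.Ventures.LatticeQCDFlow.Exactness

open Matrix MeasureTheory WithLp Metric Complex ProbabilityTheory Measure Set
open scoped ENNReal

variable {n : Type*} [Fintype n] [DecidableEq n]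

/-! ## §3 Frames, their pairs, and the lexicographic word; inversion reverses words -/

section Frames

variable {m : Type*} [Fintype m] [DecidableEq m]

/-- The ordered coordinate pair of a subgroup frame. -/
def pairOf (e : n ≃ Fin 2 ⊕ m) : n × n := (e.symm (Sum.inl 0), e.symm (Sum.inl 1))

omit [Fintype n] [DecidableEq n] [Fintype m] [DecidableEq m] in
/-- The two coordinates of a frame are distinct. -/
theorem pairOf_ne (e : n ≃ Fin 2 ⊕ m) : e.symm (Sum.inl 0) ≠ e.symm (Sum.inl 1) := by
  intro h
  have := e.symm.injective h
  simp at this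

omit [Fintype n] [Fintype m] in
/-- **Entries of the block embedding depend only on the pair of the frame.** -/
theorem blockEmb_apply_eq (e : n ≃ Fin 2 ⊕ m) (A : Matrix (Fin 2) (Fin 2) ℂ) (x y : n) :
    blockEmb e A x y =
      if x = e.symm (Sum.inl 0) then
        (if y = e.symm (Sum.inl 0) then A 0 0 else if y = e.symm (Sum.inl 1) then A 0 1 else 0)
      else if x = e.symm (Sum.inl 1) then
        (if y = e.symm (Sum.inl 0) then A 1 0 else if y = e.symm (Sum.inl 1) then A 1 1 else 0)
      else (if x = y then 1 else 0) := by
  have hx : ∀ (z : n) (k : Fin 2), z = e.symm (Sum.inl k) ↔ e z = Sum.inl k := fun z k => by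
    rw [Equiv.eq_symm_apply]
  have h01 : e.symm (Sum.inl 0) ≠ e.symm (Sum.inl 1) := pairOf_ne e
  rw [blockEmb, Matrix.submatrix_apply]
  rcases hex : e x with p | r <;> rcases hey : e y with q | t
  · -- both in the block
    fin_cases p <;> fin_cases q <;>
      simp [Matrix.fromBlocks_apply₁₁, (hx x _).2 hex, (hx y _).2 hey, h01.symm]
  · fin_cases p
    · have hy0 : y ≠ e.symm (Sum.inl 0) := fun h => by rw [(hx y 0).1 h] at hey; cases hey
      have hy1 : y ≠ e.symm (Sum.inl 1) := fun h => by rw [(hx y 1).1 h] at hey; cases hey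
      simp [Matrix.fromBlocks_apply₁₂, (hx x _).2 hex, hy0, hy1]
    · have hy0 : y ≠ e.symm (Sum.inl 0) := fun h => by rw [(hx y 0).1 h] at hey; cases hey
      have hy1 : y ≠ e.symm (Sum.inl 1) := fun h => by rw [(hx y 1).1 h] at hey; cases hey
      simp [Matrix.fromBlocks_apply₁₂, (hx x _).2 hex, hy0, hy1, h01.symm]
  · have hx0 : x ≠ e.symm (Sum.inl 0) := fun h => by rw [(hx x 0).1 h] at hex; cases hex
    have hx1 : x ≠ e.symm (Sum.inl 1) := fun h => by rw [(hx x 1).1 h] at hex; cases hex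
    have hxy : x ≠ y := fun h => by rw [h, hey] at hex; cases hex
    simp [Matrix.fromBlocks_apply₂₁, hx0, hx1, hxy]
  · have hx0 : x ≠ e.symm (Sum.inl 0) := fun h => by rw [(hx x 0).1 h] at hex; cases hex
    have hx1 : x ≠ e.symm (Sum.inl 1) := fun h => by rw [(hx x 1).1 h] at hex; cases hex
    have hrt : r = t ↔ x = y := by
      constructor
      · intro h; apply e.injective; rw [hex, hey, h]
      · intro h; rw [h, hey] at hex; cases hex; rfl
    simp [Matrix.fromBlocks_apply₂₂, hx0, hx1, Matrix.one_apply, hrt]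

/-- **Frames with the same pair embed SU(2) identically**: `blockEmbSU e = pairHom a b` with
`(a, b) = pairOf e`. -/
theorem blockEmbSU_eq_pairHom (e : n ≃ Fin 2 ⊕ m) :
    (blockEmbSU e : Matrix.specialUnitaryGroup (Fin 2) ℂ → Matrix.specialUnitaryGroup n ℂ) =
      pairHom (e.symm (Sum.inl 0)) (e.symm (Sum.inl 1)) (pairOf_ne e) := by
  funext A
  apply Subtype.ext
  change blockEmb e (A : Matrix (Fin 2) (Fin 2) ℂ) =
    blockEmb (pairFrame (e.symm (Sum.inl 0)) (e.symm (Sum.inl 1)) (pairOf_ne e)) (A : Matrix (Fin 2) (Fin 2) ℂ)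
  ext x y
  rw [blockEmb_apply_eq, blockEmb_apply_eq]
  have h0 : (pairFrame (e.symm (Sum.inl 0)) (e.symm (Sum.inl 1)) (pairOf_ne e)).symm (Sum.inl 0) = e.symm (Sum.inl 0) := by
    rw [Equiv.symm_apply_eq]; exact (pairFrame_apply_left _ _ _).symm
  have h1 : (pairFrame (e.symm (Sum.inl 0)) (e.symm (Sum.inl 1)) (pairOf_ne e)).symm (Sum.inl 1) = e.symm (Sum.inl 1) := by
    rw [Equiv.symm_apply_eq]; exact (pairFrame_apply_right _ _ _).symm
  rw [h0, h1]

variable [Nonempty n]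

omit [Nonempty n] in
/-- Hence the kick law of a frame is the pair law of its pair. -/
theorem map_blockEmbSU_eq_pairLaw' (e : n ≃ Fin 2 ⊕ m) :
    haarSU2.map (blockEmbSU e) = pairLaw' (pairOf e).1 (pairOf e).2 := by
  rw [pairOf, pairLaw'_of_ne (pairOf_ne e), pairLaw, pairHom, blockEmbSU_eq_pairHom]
  rfl

omit [DecidableEq n] [Nonempty n] in
/-- The lexicographic list of ordered pairs of a list of coordinates: `(a₀,a₁), (a₀,a₂), …, (a₁,a₂), …`. -/
def lexPairs : List n → List (n × n)
  | [] => []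
  | a :: l => l.map (fun j => (a, j)) ++ lexPairs l

omit [Nonempty n] in
/-- The lexicographic law is the list convolution over the lexicographic pairs. -/
theorem lexLaw_eq_listConv : ∀ (L : List n),
    lexLaw L = listConv ((lexPairs L).map fun p => pairLaw' p.1 p.2)
  | [] => rfl
  | a :: l => by
      rw [lexLaw_cons, lexPairs, List.map_append, listConv_append _ _ (fun μ hμ => by
          obtain ⟨p, -, rfl⟩ := List.mem_map.1 hμ; infer_instance) (fun μ hμ => by
          obtain ⟨p, -, rfl⟩ := List.mem_map.1 hμ; infer_instance),
        ← lexLaw_eq_listConv l, blockLaw, List.map_map]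
      rfl

omit [Nonempty n] in
/-- Inversion reverses a convolution. -/
theorem map_inv_mconv (μ ν : Measure (Matrix.specialUnitaryGroup n ℂ)) [SFinite μ] [SFinite ν] :
    (μ ∗ₘ ν).map (fun g => g⁻¹) = ν.map (fun g => g⁻¹) ∗ₘ μ.map (fun g => g⁻¹) := by
  rw [Measure.mconv, Measure.map_map measurable_inv measurable_mul, Measure.mconv,
    Measure.map_prod_map _ _ measurable_inv measurable_inv, ← Measure.prod_swap (μ := μ) (ν := ν),
    Measure.map_map (measurable_inv.prodMap measurable_inv) measurable_swap,
    Measure.map_map measurable_mul ((measurable_inv.prodMap measurable_inv).comp measurable_swap)]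
  congr 1
  funext p
  simp [_root_.mul_inv_rev]

omit [Nonempty n] in
/-- Inversion reverses a list convolution. -/
theorem map_inv_listConv : ∀ (l : List (Measure (Matrix.specialUnitaryGroup n ℂ))),
    (∀ μ ∈ l, IsProbabilityMeasure μ) →
      (listConv l).map (fun g => g⁻¹) = listConv (l.map fun μ => μ.map (fun g => g⁻¹)).reverse
  | [], _ => by
      rw [listConv_nil, Measure.map_dirac' measurable_inv, inv_one, List.map_nil, List.reverse_nil, listConv_nil]
  | μ :: l, h => by
      haveI := h μ (by simp)
      haveI := isProbabilityMeasure_listConv l fun ν hν => h ν (by simp [hν])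
      have hl : ∀ ν ∈ (l.map fun μ => μ.map (fun g => g⁻¹)).reverse, IsProbabilityMeasure ν := fun ν hν => by
        rw [List.mem_reverse] at hν
        obtain ⟨ν', hν', rfl⟩ := List.mem_map.1 hν
        haveI := h ν' (by simp [hν'])
        exact Measure.isProbabilityMeasure_map measurable_inv.aemeasurable
      rw [listConv_cons, map_inv_mconv, map_inv_listConv l (fun ν hν => h ν (by simp [hν])), List.map_cons,
        List.reverse_cons, listConv_append _ _ hl (fun ν hν => by
          rw [List.mem_singleton] at hν; rw [hν]
          exact Measure.isProbabilityMeasure_map measurable_inv.aemeasurable),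
        listConv_cons, listConv_nil, Measure.mconv_dirac_one]

omit [Nonempty n] in
/-- The pair laws are inversion invariant. -/
theorem pairLaw'_map_inv (a b : n) : (pairLaw' a b).map (fun g => g⁻¹) = pairLaw' a b := by
  unfold pairLaw'
  split_ifs with h
  · rw [Measure.map_dirac' measurable_inv, inv_one]
  · rw [pairLaw, Measure.map_map measurable_inv (measurable_pairHom a b h)]
    have hc : (fun g : Matrix.specialUnitaryGroup n ℂ => g⁻¹) ∘ (pairHom a b h) = (pairHom a b h) ∘ (fun g => g⁻¹) := by
      funext g; simp
    rw [hc, ← Measure.map_map (measurable_pairHom a b h) measurable_inv, Measure.map_inv_eq_self]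

/-- **Haar is dominated by the list convolution of the pair laws over the lexicographic word, and
over its reverse** (the engine's backward and forward scans). -/
theorem smul_haar_le_listConv_pairs [LinearOrder n] {ps : List (n × n)}
    (hps : ps = lexPairs (Finset.univ.sort (· ≤ ·) : List n) ∨ ps = (lexPairs (Finset.univ.sort (· ≤ ·) : List n)).reverse) :
    ∃ c : ℝ≥0∞, c ≠ 0 ∧
      c • Literature.MathematicalPhysics.QuantumFieldTheory.haarProbability (Matrix.specialUnitaryGroup n ℂ) ≤
        listConv (ps.map fun p => pairLaw' p.1 p.2) := by
  obtain ⟨c, hc, h⟩ := smul_haar_le_lexLaw (n := n)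
  rw [lexLaw_eq_listConv] at h
  refine ⟨c, hc, ?_⟩
  rcases hps with rfl | rfl
  · exact h
  · have h2 := Measure.map_mono h measurable_inv
    rw [Measure.map_smul, Measure.map_inv_eq_self, map_inv_listConv _ (fun μ hμ => by
        obtain ⟨p, -, rfl⟩ := List.mem_map.1 hμ; infer_instance), List.map_map] at h2
    have hfun : ((fun μ : Measure (Matrix.specialUnitaryGroup n ℂ) => μ.map (fun g => g⁻¹)) ∘
        fun p : n × n => pairLaw' p.1 p.2) = fun p => pairLaw' p.1 p.2 := by
      funext p; exact pairLaw'_map_inv p.1 p.2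
    rwa [hfun, ← List.map_reverse] at h2

end Frames


end Summit.Ventures.LatticeQCDFlow.Exactness
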